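import Literature.NumberTheory.GaloisRepresentations.ContinuousRepHomDual
import HarnessLib

/-!
# Local Tate duality: the dévissage (Serre II §5.2, proof of Thm. 2)

Serre, *Cohomologie galoisienne*, II §5.2, Théorème 2 (Tate): for a finite `G_k`-module `A` over a
`p`-adic field and `A' = Hom(A, μ)`, the cup product `H¹(k, A) × H¹(k, A') → H²(k, μ) = ℚ/ℤ` is a
perfect duality; the case `i = 1` is "purement formel" from `i = 0, 2`: "par dévissage … on peut
supposer que `A` est un module simple … isomorphe à `ℤ/pℤ` [après passage à une extension de degré
premier à `p`]", the five-lemma being applied to the cohomology sequences of `0 → B → A → C → 0`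
and of the dual sequence `0 → C' → A' → B' → 0` (Milne, *Arithmetic Duality Theorems*, I, proof of
Thm. 2.1 / Cor. 2.3, the same diagram).

This file proves the **abstract induction step and induction** of that dévissage for Mathlib's
continuous cohomology, for an arbitrary locally compact group `G`, a discrete `G`-module `Ω`
isomorphic to `ℤ/n` (in the application `Ω = μₙ`, `G = Γ_E` for a finite extension `E` of a local
field) and an additive `ι : H²(G, Ω) → ℤ/n` (the invariant map):

* `ContinuousRep.dualityPairing ω ι ρ : H¹(G, M) → H¹(G, M^D) → ℤ/n`, `(a, b) ↦ ι(a ∪ b)` for the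
  evaluation pairing `M × M^D → Ω` (`ContinuousRepHomDual.lean`), and the degree `(0, 2)` maps
  `zeroTwo ω ι ρ w : H²(G, M^D) → ℤ/n`, `z ↦ ι(H²(⟨w, ·⟩) z)` for an invariant `w`;
* `exists_quotient_line` — a finite `p`-primary `M ≠ 0` on which `G` acts through a finite
  `p`-group `G/N₀` has a stable submodule `N` with `M/N` of order `p` and trivial action (maximal
  proper stable submodule + the fixed-point theorem `exists_ne_zero_forall_apply_eq`);
* `dualityPairing_injective_of_devissage` — **THE DÉVISSAGE**: if for every `W` of order `p` with
  trivial action (1,1) the left adjoint `H¹(G, W) → Hom(H¹(G, W^D), ℤ/n)` is injective and (0,2)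
  `z ↦ (w ↦ ι(H²(⟨w,·⟩) z)) : H²(G, W^D) → (W → ℤ/n)` is injective, then for every finite
  `p`-primary `M` killed by `n` on which `N₀` acts trivially, the left adjoint
  `H¹(G, M) → Hom(H¹(G, M^D), ℤ/n)` is injective.

The induction (on `|M|`, through `0 → N → M → M/N → 0` with `M/N ≅ ℤ/p` trivial) is the diagram
chase of the injective four-lemma, done with the exactness statements of
`ContinuousCohomologyConnecting.lean`, the adjoint naturality of cup products and their
compatibility with the connecting maps (`ContinuousCupProductCompat.lean`), and one counting step
in groups of order `p` replacing the surjectivity `M₂^Γ → H²(M₂')^*` of the printed five-lemma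
(`exists_apply_eq_of_rightNondegenerate`).  No finiteness of cohomology is used.

## References

* J.-P. Serre, *Cohomologie galoisienne*, 5e éd. (1994) / *Galois Cohomology* (1997), II §5.2,
  Théorème 2 and its proof. [SerreGaloisCohomology1997]
* J. S. Milne, *Arithmetic Duality Theorems*, 2nd ed. (2006), I §2, Thm. 2.1, Cor. 2.3.
  [MilneADT2006]
-/

noncomputable section

open CategoryTheory Limits Function

universe u w

namespace Literature.NumberTheory.GaloisRepresentations

open _root_.TopRep _root_.ContRepresentation _root_.ContinuousCohomology

/-! ### Torsion of `H²` -/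

section Torsion

variable {R : Type w} [CommRing R] [TopologicalSpace R]
variable {G : Type u} [Group G] [TopologicalSpace G] [IsTopologicalGroup G] [LocallyCompactSpace G]

/-- **`H²(G, X)` is killed by `n` if `X` is.** [folklore] -/
theorem nsmul_continuousCohomology_two_eq_zero (X : TopRep.{u} R G) (n : ℕ)
    (hX : ∀ x : X, n • x = 0) (z : continuousCohomology 2 X) : n • z = 0 := by
  obtain ⟨f, rfl⟩ := twoCocycleClass_surjective X z
  have hf : (n : R) • f = 0 := Subtype.ext (ContinuousMap.ext fun q => by
    change (n : R) • f.1 q = 0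
    rw [Nat.cast_smul_eq_nsmul, hX])
  rw [← Nat.cast_smul_eq_nsmul R, ← twoCocycleClass_smul, hf, twoCocycleClass_zero]

end Torsion

/-! ### The pairings `H¹ × H¹ → ℤ/n` and `H⁰ × H² → ℤ/n` -/

namespace ContinuousRep

section Pairings

variable {G : Type u} [Group G] [TopologicalSpace G] [IsTopologicalGroup G] [LocallyCompactSpace G]
variable {Ω : Type u} [AddCommGroup Ω] [TopologicalSpace Ω] [DiscreteTopology Ω] {n : ℕ}
variable {M : Type u} [AddCommGroup M] [TopologicalSpace M] [DiscreteTopology M] [Finite M]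

/-- **The duality pairing `H¹(G, M) × H¹(G, M^D) → ℤ/n`, `(a, b) ↦ ι(a ∪ b)`**, cup product for
the evaluation pairing `M × Hom(M, Ω) → Ω` followed by `ι : H²(G, Ω) → ℤ/n` (the local Tate
pairing when `G = Γ_K`, `Ω = μₙ`, `ι = inv`). [cite: SerreGaloisCohomology1997, II §5.2 Thm. 2] -/
def dualityPairing (ρ : ContinuousRep G ℤ M) (ω : ContinuousRep G ℤ Ω)
    (ι : continuousCohomology 2 ω.toTopRep →+ ZMod n) :
    continuousCohomology 1 ρ.toTopRep →+ continuousCohomology 1 (ρ.homRep ω).toTopRep →+ ZMod n :=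
  AddMonoidHom.mk' (fun a => ι.comp ((ρ.evalPairing ω).cupProduct a).toAddMonoidHom) fun a a' => by
    refine AddMonoidHom.ext fun b => ?_
    simp only [AddMonoidHom.coe_comp, comp_apply, LinearMap.toAddMonoidHom_coe, map_add,
      LinearMap.add_apply, AddMonoidHom.add_apply]

/-- Unfolding `dualityPairing`. [folklore] -/
@[simp] theorem dualityPairing_apply (ρ : ContinuousRep G ℤ M) (ω : ContinuousRep G ℤ Ω)
    (ι : continuousCohomology 2 ω.toTopRep →+ ZMod n) (a : continuousCohomology 1 ρ.toTopRep)
    (b : continuousCohomology 1 (ρ.homRep ω).toTopRep) :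
    ρ.dualityPairing ω ι a b = ι ((ρ.evalPairing ω).cupProduct a b) := rfl

/-- **The degree `(0, 2)` pairing with an invariant `w ∈ M`**: `z ↦ ι(H²(⟨w, ·⟩) z)`,
`H²(G, M^D) → ℤ/n`, where `⟨w, ·⟩ : M^D → Ω` is evaluation at `w` (`ContPairing.leftHom`).
[cite: SerreGaloisCohomology1997, II §5.2 Thm. 2] -/
def zeroTwo (ρ : ContinuousRep G ℤ M) (ω : ContinuousRep G ℤ Ω)
    (ι : continuousCohomology 2 ω.toTopRep →+ ZMod n) (w : M) (hw : ∀ g : G, ρ g w = w) :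
    continuousCohomology 2 (ρ.homRep ω).toTopRep →+ ZMod n :=
  ι.comp (cohomologyMap ((ρ.evalPairing ω).leftHom w hw) 2).hom.toLinearMap.toAddMonoidHom

omit [LocallyCompactSpace G] in
/-- Unfolding `zeroTwo`. [folklore] -/
@[simp] theorem zeroTwo_apply (ρ : ContinuousRep G ℤ M) (ω : ContinuousRep G ℤ Ω)
    (ι : continuousCohomology 2 ω.toTopRep →+ ZMod n) (w : M) (hw : ∀ g : G, ρ g w = w)
    (z : continuousCohomology 2 (ρ.homRep ω).toTopRep) :
    ρ.zeroTwo ω ι w hw z = ι (cohomologyMap ((ρ.evalPairing ω).leftHom w hw) 2 z) := rfl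

/-- `zeroTwo` is additive in the invariant element. [folklore] -/
theorem zeroTwo_add (ρ : ContinuousRep G ℤ M) (ω : ContinuousRep G ℤ Ω)
    (ι : continuousCohomology 2 ω.toTopRep →+ ZMod n) (w w' : M) (hw : ∀ g : G, ρ g w = w)
    (hw' : ∀ g : G, ρ g w' = w') (hww : ∀ g : G, ρ g (w + w') = w + w')
    (z : continuousCohomology 2 (ρ.homRep ω).toTopRep) :
    ρ.zeroTwo ω ι (w + w') hww z = ρ.zeroTwo ω ι w hw z + ρ.zeroTwo ω ι w' hw' z := by
  obtain ⟨c, rfl⟩ := twoCocycleClass_surjective _ z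
  rw [zeroTwo_apply, zeroTwo_apply, zeroTwo_apply, cohomologyMap_twoCocycleClass,
    cohomologyMap_twoCocycleClass, cohomologyMap_twoCocycleClass, ← map_add, ← twoCocycleClass_add]
  congr 2
  refine Subtype.ext (ContinuousMap.ext fun q => ?_)
  obtain ⟨σ, τ⟩ := q
  change (ρ.evalPairing ω).toLin (w + w') (c.1 (σ, τ)) =
    (ρ.evalPairing ω).toLin w (c.1 (σ, τ)) + (ρ.evalPairing ω).toLin w' (c.1 (σ, τ))
  rw [LinearMap.map_add₂]

/-- The (0,2)-map as a bi-additive map `M^G × H²(G, M^D) → ℤ/n` for a trivial module.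
[folklore] -/
def zeroTwoHom (ρ : ContinuousRep G ℤ M) (ω : ContinuousRep G ℤ Ω)
    (ι : continuousCohomology 2 ω.toTopRep →+ ZMod n) (hρ : ∀ (g : G) (w : M), ρ g w = w) :
    M →+ continuousCohomology 2 (ρ.homRep ω).toTopRep →+ ZMod n :=
  AddMonoidHom.mk' (fun w => ρ.zeroTwo ω ι w (hρ · w)) fun w w' =>
    AddMonoidHom.ext fun z => ρ.zeroTwo_add ω ι w w' _ _ _ z

/-- `H²(G, M^D)` is killed by `n` if `M` is. [folklore] -/
theorem nsmul_continuousCohomology_homRep_eq_zero (ρ : ContinuousRep G ℤ M) (ω : ContinuousRep G ℤ Ω)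
    (hM : ∀ m : M, n • m = 0) (z : continuousCohomology 2 (ρ.homRep ω).toTopRep) : n • z = 0 :=
  nsmul_continuousCohomology_two_eq_zero (ρ.homRep ω).toTopRep n
    (fun f => HomCarrier.nsmul_eq_zero_of_left hM f) z

/-- Unfolding `zeroTwoHom`. [folklore] -/
@[simp] theorem zeroTwoHom_apply (ρ : ContinuousRep G ℤ M) (ω : ContinuousRep G ℤ Ω)
    (ι : continuousCohomology 2 ω.toTopRep →+ ZMod n) (hρ : ∀ (g : G) (w : M), ρ g w = w)
    (w : M) : ρ.zeroTwoHom ω ι hρ w = ρ.zeroTwo ω ι w (hρ · w) := rfl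

end Pairings

end ContinuousRep

/-! ### Quotient lines of a `p`-primary module over a `p`-group -/

section QuotientLine

variable {G : Type u} [Group G] [TopologicalSpace G] [IsTopologicalGroup G]
variable {M : Type u} [AddCommGroup M] [TopologicalSpace M] [DiscreteTopology M] [Finite M]

/-- **A finite `p`-primary module `M ≠ 0` on which `G` acts through a finite `p`-group has a
stable submodule `N` with `M/N` of order `p` and trivial action** (take `N` maximal among proper
stable submodules; `M/N` has a non-zero fixed vector `b₁` of order `p` by the fixed-point theorem,
and the preimage of the stable line `ℤ b₁` is `M` by maximality).  This is the reduction "on peut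
supposer que `A` est … isomorphe à `ℤ/pℤ`" of Serre II §5.2.
[cite: SerreGaloisCohomology1997, II §5.2 (proof of Thm. 2)] -/
theorem exists_quotient_line {p : ℕ} [hp : Fact p.Prime] (N₀ : Subgroup G) [N₀.Normal]
    [Finite (G ⧸ N₀)] (hQ : IsPGroup p (G ⧸ N₀)) [Nontrivial M] (ρ : ContinuousRep G ℤ M)
    (hM : IsPrimaryTorsion p M) (hN₀ : ∀ g ∈ N₀, ∀ m : M, ρ g m = m) :
    ∃ (N : Submodule ℤ M) (hN : ∀ g, N ≤ N.comap (ρ g)),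
      Nat.card (M ⧸ N) = p ∧ ∀ (g : G) (q : M ⧸ N), ρ.quotient N hN g q = q := by
  classical
  -- a maximal proper stable submodule
  let S : Set (Submodule ℤ M) := {N | (∀ g, N ≤ N.comap (ρ g)) ∧ N ≠ ⊤}
  haveI : Finite (Submodule ℤ M) :=
    Finite.of_injective (fun N : Submodule ℤ M => (N : Set M)) SetLike.coe_injective
  have hSne : S.Nonempty := ⟨⊥, fun g => bot_le, bot_ne_top⟩
  obtain ⟨N, hNmax⟩ := S.toFinite.exists_maximal hSne
  obtain ⟨hN, hNtop⟩ := hNmax.prop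
  refine ⟨N, hN, ?_⟩
  -- the quotient `Q = M/N` and a fixed line in it
  let ρQ := ρ.quotient N hN
  haveI : Nontrivial (M ⧸ N) := Submodule.Quotient.nontrivial_iff.2 hNtop
  have hQN₀ : ∀ g ∈ N₀, ∀ q : M ⧸ N, ρQ g q = q := fun g hg q => by
    induction q using Submodule.Quotient.induction_on with
    | _ m => rw [ContinuousRep.quotient_apply_mk, hN₀ g hg m]
  obtain ⟨b, hb0, hbfix⟩ := exists_ne_zero_forall_apply_eq N₀ hQ ρQ (hM.quotient N) hQN₀
  obtain ⟨b₁, hb₁0, hpb₁, hb₁fix⟩ := exists_line ρQ (hM.quotient N) b hb0 hbfix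
  let L : Submodule ℤ (M ⧸ N) := Submodule.span ℤ {b₁}
  have hL : ∀ g, L ≤ L.comap (ρQ g) := span_singleton_le_comap ρQ b₁ hb₁fix
  -- the preimage of `L` is a stable submodule containing `N`, hence `M` by maximality
  have hLtop : L = ⊤ := by
    by_contra hLt
    let N' : Submodule ℤ M := L.comap N.mkQ
    have hN' : ∀ g, N' ≤ N'.comap (ρ g) := fun g x hx => by
      change N.mkQ (ρ g x) ∈ L
      have : N.mkQ (ρ g x) = ρQ g (N.mkQ x) := rfl
      rw [this]
      exact hL g hx
    have hN'top : N' ≠ ⊤ := fun h => hLt (by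
      rw [eq_top_iff]
      intro q _
      obtain ⟨m, rfl⟩ := N.mkQ_surjective q
      have hm : m ∈ N' := h ▸ Submodule.mem_top
      exact hm)
    have hNN' : N ≤ N' := fun x hx => by
      change N.mkQ x ∈ L
      have h0 : N.mkQ x = 0 := (Submodule.Quotient.mk_eq_zero N).2 hx
      rw [h0]
      exact zero_mem L
    have hEq : N = N' := hNmax.eq_of_le ⟨hN', hN'top⟩ hNN'
    have hb₁L : b₁ ∈ L := Submodule.mem_span_singleton_self b₁
    obtain ⟨m, hm⟩ := N.mkQ_surjective b₁
    have hmN' : m ∈ N' := by change N.mkQ m ∈ L; rw [hm]; exact hb₁L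
    rw [← hEq] at hmN'
    exact hb₁0 (by rw [← hm]; exact (Submodule.Quotient.mk_eq_zero N).2 hmN')
  refine ⟨?_, fun g q => ?_⟩
  · rw [← natCard_span_singleton b₁ hb₁0 hpb₁]
    change Nat.card (M ⧸ N) = Nat.card L
    rw [hLtop]
    exact (Nat.card_congr (Submodule.topEquiv (R := ℤ) (M := M ⧸ N)).toEquiv).symm
  · have hq : q ∈ L := hLtop ▸ Submodule.mem_top
    obtain ⟨a, rfl⟩ := Submodule.mem_span_singleton.1 hq
    change ρQ g (a • b₁) = a • b₁
    rw [map_zsmul]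
    exact congrArg (fun x => a • x) (hb₁fix g)

end QuotientLine

/-! ### A counting lemma in groups of order `p` -/

section Counting

/-- **Counting step of the dévissage.**  Let `W` have prime order `p ∣ n`, let `S` be killed by
`n`, and let `B : W × S → ℤ/n` be bi-additive with trivial right kernel.  Then every additive
`S → ℤ/n` is `B(w, ·)` for some `w` (`S` embeds in `Hom(W, ℤ/n)`, of order `p`, so `|S| ≤ p`;
if `S ≠ 0` then `w ↦ B(w, ·)` is injective on the group `W` of prime order, hence onto
`Hom(S, ℤ/n)`, of order `|S| ≤ p`). [folklore] -/
theorem exists_apply_eq_of_rightNondegenerate {p n : ℕ} [hp : Fact p.Prime] [NeZero n]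
    (hpn : p ∣ n) {W S : Type*} [AddCommGroup W] [AddCommGroup S] [Finite W] (hW : Nat.card W = p)
    (hS : ∀ s : S, n • s = 0) (B : W →+ S →+ ZMod n) (hB : ∀ s : S, (∀ w, B w s = 0) → s = 0)
    (lam : S →+ ZMod n) : ∃ w : W, B w = lam := by
  classical
  -- `n W = 0`
  have hWn : ∀ w : W, n • w = 0 := fun w => by
    obtain ⟨k, hk⟩ := hpn
    have hpw : p • w = 0 := by rw [← hW]; exact card_nsmul_eq_zero'
    rw [hk, mul_nsmul, hpw, nsmul_zero]
  -- `S` embeds into `Hom(W, ℤ/n)`, hence is finite of order `≤ p`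
  haveI : Finite (W →+ ZMod n) := finite_addMonoidHom_zmod W n
  have hinj : Injective B.flip := (injective_iff_map_eq_zero _).2 fun s hs => hB s fun w => by
    have := congrArg (fun φ : W →+ ZMod n => φ w) hs
    simpa using this
  haveI : Finite S := Finite.of_injective _ hinj
  have hScard : Nat.card S ≤ p :=
    calc Nat.card S ≤ Nat.card (W →+ ZMod n) := Nat.card_le_card_of_injective _ hinj
      _ = Nat.card W := Nat.card_addMonoidHom_zmod hWn
      _ = p := hW
  haveI : Finite (S →+ ZMod n) := finite_addMonoidHom_zmod S n
  have hHomS : Nat.card (S →+ ZMod n) = Nat.card S := Nat.card_addMonoidHom_zmod hS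
  by_cases hS0 : Subsingleton S
  · refine ⟨0, AddMonoidHom.ext fun s => ?_⟩
    rw [Subsingleton.elim s 0, map_zero, map_zero]
  haveI : Nontrivial S := not_subsingleton_iff_nontrivial.1 hS0
  obtain ⟨s₀, hs₀⟩ := exists_ne (0 : S)
  -- `B` is injective on the group `W` of prime order
  haveI : Fact (Nat.card W).Prime := ⟨hW ▸ hp.out⟩
  have hBinj : Injective B := by
    rcases B.ker.eq_bot_or_eq_top_of_prime_card with hker | hker
    · exact (AddMonoidHom.ker_eq_bot_iff B).1 hker
    · exact absurd (hB s₀ fun w => by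
        have hw : w ∈ B.ker := hker ▸ AddSubgroup.mem_top w
        rw [AddMonoidHom.mem_ker] at hw
        rw [hw, AddMonoidHom.zero_apply]) hs₀
  -- hence onto `Hom(S, ℤ/n)`, of order `|S| ≤ p = |W|`
  have hR : Nat.card B.range = p := by
    rw [← hW]
    exact (Nat.card_congr (AddMonoidHom.ofInjective hBinj).toEquiv).symm
  have hle : Nat.card B.range ≤ Nat.card (S →+ ZMod n) :=
    Nat.card_le_card_of_injective _ (AddSubgroup.subtype_injective B.range)
  have htop : B.range = ⊤ :=
    AddSubgroup.eq_top_of_card_eq _ (le_antisymm hle (by rw [hHomS, hR]; exact hScard))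
  have hmem : lam ∈ B.range := htop ▸ AddSubgroup.mem_top lam
  exact AddMonoidHom.mem_range.1 hmem

end Counting

/-! ### The dévissage -/

section Devissage

variable {G : Type u} [Group G] [TopologicalSpace G] [IsTopologicalGroup G] [LocallyCompactSpace G]
variable {Ω : Type u} [AddCommGroup Ω] [TopologicalSpace Ω] [DiscreteTopology Ω]

/-- **Local Tate duality, the dévissage** (Serre II §5.2, proof of Thm. 2, `i = 1`; Milne ADT I,
proof of Thm. 2.1 / Cor. 2.3).  Let `G` be a locally compact group, `Ω ≃ ℤ/n` a discrete
`G`-module, `ι : H²(G, Ω) → ℤ/n` additive, `p ∣ n` a prime and `N₀ ⊴ G` with `G/N₀` a finite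
`p`-group.  Suppose that for every `G`-module `W` of order `p` with trivial action
* (1,1) `a ↦ ι(a ∪ ·) : H¹(G, W) → Hom(H¹(G, W^D), ℤ/n)` is injective, and
* (0,2) `z ↦ (w ↦ ι(H²(⟨w, ·⟩) z)) : H²(G, W^D) → (W → ℤ/n)` is injective.
Then for every finite `p`-primary discrete `G`-module `M` killed by `n` on which `N₀` acts trivially,
`a ↦ ι(a ∪ ·) : H¹(G, M) → Hom(H¹(G, M^D), ℤ/n)` is injective (`M^D = Hom(M, Ω)`).
Proof: induction on `|M|` via `0 → N → M → M/N → 0` with `M/N ≅ ℤ/p` trivial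
(`exists_quotient_line`) and the dual sequence `0 → (M/N)^D → M^D → N^D → 0`; the chase of the
module docstring. [cite: SerreGaloisCohomology1997, II §5.2 Thm. 2 (proof)] -/
theorem dualityPairing_injective_of_devissage (ω : ContinuousRep G ℤ Ω) {n : ℕ} [NeZero n]
    (eΩ : Ω ≃+ ZMod n) (ι : continuousCohomology 2 ω.toTopRep →+ ZMod n) {p : ℕ} [hp : Fact p.Prime]
    (hpn : p ∣ n) (N₀ : Subgroup G) [N₀.Normal] [Finite (G ⧸ N₀)] (hQ : IsPGroup p (G ⧸ N₀))
    (h11 : ∀ (W : Type u) [AddCommGroup W] [TopologicalSpace W] [DiscreteTopology W] [Finite W]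
      (τ : ContinuousRep G ℤ W), (∀ (g : G) (w : W), τ g w = w) → Nat.card W = p →
      Injective (τ.dualityPairing ω ι))
    (h02 : ∀ (W : Type u) [AddCommGroup W] [TopologicalSpace W] [DiscreteTopology W] [Finite W]
      (τ : ContinuousRep G ℤ W) (hτ : ∀ (g : G) (w : W), τ g w = w), Nat.card W = p →
      ∀ z : continuousCohomology 2 (τ.homRep ω).toTopRep,
        (∀ w : W, τ.zeroTwo ω ι w (hτ · w) z = 0) → z = 0)
    (M : Type u) [AddCommGroup M] [TopologicalSpace M] [DiscreteTopology M] [Finite M]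
    (ρ : ContinuousRep G ℤ M) (hpM : IsPrimaryTorsion p M) (hM : ∀ m : M, n • m = 0)
    (hN₀ : ∀ g ∈ N₀, ∀ m : M, ρ g m = m) :
    Injective (ρ.dualityPairing ω ι) := by
  classical
  suffices key : ∀ (k : ℕ) (M : Type u) [AddCommGroup M] [TopologicalSpace M] [DiscreteTopology M]
      [Finite M] (ρ : ContinuousRep G ℤ M), IsPrimaryTorsion p M → (∀ m : M, n • m = 0) →
      (∀ g ∈ N₀, ∀ m : M, ρ g m = m) → Nat.card M = k → Injective (ρ.dualityPairing ω ι) from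
    key _ M ρ hpM hM hN₀ rfl
  intro k
  induction k using Nat.strong_induction_on with
  | _ k ih =>
  intro M _ _ _ _ ρ hpM hM hN₀ hk
  by_cases hsub : Subsingleton M
  · haveI := subsingleton_continuousCohomology_of_subsingleton ρ.toTopRep 0
    exact fun a b _ => Subsingleton.elim a b
  haveI : Nontrivial M := not_subsingleton_iff_nontrivial.1 hsub
  obtain ⟨N, hN, hcard, htriv⟩ := exists_quotient_line N₀ hQ ρ hpM hN₀
  -- the two short exact sequences
  have hSES₁ : IsSES (subtypeHom ρ N hN) (ρ.mkQHom N hN) := isSES_subtype_mkQ ρ N hN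
  have hSES₂ : IsSES (ContinuousRep.homRepMap ω (ρ.mkQHom N hN))
      (ContinuousRep.homRepMap ω (subtypeHom ρ N hN)) :=
    ContinuousRep.isSES_homRepMap_mkQ_subtype ρ ω N hN eΩ hM
  -- the induction hypothesis for `N`
  have hNcard : Nat.card N < k := by
    have hmul : Nat.card M = Nat.card N * Nat.card (M ⧸ N) :=
      Submodule.card_eq_card_quotient_mul_card N
    rw [hk, hcard] at hmul
    rw [hmul]
    exact (Nat.lt_mul_iff_one_lt_right Nat.card_pos).2 hp.out.one_lt
  have hNn : ∀ x : N, n • x = 0 := fun x => Subtype.ext (by simp [hM])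
  have hNN₀ : ∀ g ∈ N₀, ∀ x : N, ρ.subrepresentation N hN g x = x := fun g hg x =>
    Subtype.ext (by rw [ContinuousRep.subrepresentation_apply_coe, hN₀ g hg])
  have ihN : Injective ((ρ.subrepresentation N hN).dualityPairing ω ι) :=
    ih _ hNcard N (ρ.subrepresentation N hN) (hpM.submodule N) hNn hNN₀ rfl
  have hQn : ∀ q : M ⧸ N, n • q = 0 := fun q => by
    induction q using Submodule.Quotient.induction_on with
    | _ m =>
      change n • N.mkQ m = 0
      rw [← map_nsmul, hM, map_zero]
  -- the chase: let `a ∈ H¹(M)` pair to zero with `H¹(M^D)`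
  refine (injective_iff_map_eq_zero _).2 fun a ha => ?_
  -- Step 1: the image of `a` in `H¹(M/N)` pairs to zero, hence vanishes by (1,1) for `M/N`
  have h1 : cohomologyMap (ρ.mkQHom N hN) 1 a = 0 := by
    refine (injective_iff_map_eq_zero _).1 (h11 (M ⧸ N) (ρ.quotient N hN) htriv hcard) _ ?_
    refine AddMonoidHom.ext fun c => ?_
    have e := ContPairing.cupProduct_adjoint (ρ.evalPairing ω) ((ρ.quotient N hN).evalPairing ω)
      (ρ.mkQHom N hN) (ContinuousRep.homRepMap ω (ρ.mkQHom N hN)) (fun _ _ => rfl) a c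
    have ha' := congrArg
      (fun φ => φ (cohomologyMap (ContinuousRep.homRepMap ω (ρ.mkQHom N hN)) 1 c)) ha
    exact (congrArg ι e).trans ha'
  -- Step 2: `a` comes from `a₁ ∈ H¹(N)`
  obtain ⟨a₁, rfl⟩ := hSES₁.exists_map_one_eq_of_map_one_eq_zero a h1
  -- Step 3: `λ = ⟨a₁, ·⟩` kills the image of `H¹(M^D) → H¹(N^D)`
  set lam := (ρ.subrepresentation N hN).dualityPairing ω ι a₁ with hlam
  have h3 : ∀ b, lam (cohomologyMap (ContinuousRep.homRepMap ω (subtypeHom ρ N hN)) 1 b) = 0 := by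
    intro b
    have e := ContPairing.cupProduct_adjoint ((ρ.subrepresentation N hN).evalPairing ω)
      (ρ.evalPairing ω) (subtypeHom ρ N hN) (ContinuousRep.homRepMap ω (subtypeHom ρ N hN))
      (fun _ _ => rfl) a₁ b
    have ha' := congrArg (fun φ => φ b) ha
    exact (congrArg ι e).symm.trans ha'
  -- Step 4: `λ` factors through `δ₁ : H¹(N^D) → H²((M/N)^D)`
  have h4 : ∀ y y', hSES₂.δ₁ y = hSES₂.δ₁ y' → lam y = lam y' := by
    intro y y' hyy
    obtain ⟨b, hb⟩ := hSES₂.exists_map_one_eq_of_δ₁_eq_zero (y - y')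
      (by rw [map_sub, hyy, sub_self])
    rw [← sub_eq_zero, ← map_sub, ← hb]
    exact h3 b
  let S : AddSubgroup (continuousCohomology 2 ((ρ.quotient N hN).homRep ω).toTopRep) :=
    hSES₂.δ₁.toAddMonoidHom.range
  have hsec : ∀ s : S, ∃ y, hSES₂.δ₁ y = s.1 := fun s => AddMonoidHom.mem_range.1 s.2
  choose sec hsec using hsec
  let lamBar : S →+ ZMod n :=
    { toFun := fun s => lam (sec s)
      map_zero' := by
        rw [h4 (sec 0) 0 (by rw [hsec, map_zero]; rfl), map_zero]
      map_add' := fun s t => by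
        rw [← map_add, h4 (sec (s + t)) (sec s + sec t) (by rw [hsec, map_add, hsec, hsec]; rfl)] }
  have hlamBar : ∀ y, lamBar ⟨hSES₂.δ₁ y, AddMonoidHom.mem_range.2 ⟨y, rfl⟩⟩ = lam y := fun y =>
    h4 _ _ (hsec _)
  -- Step 5: `w ∈ M/N` with `⟨w, ·⟩ = -λ̄` on `S`, by (0,2) for `M/N` and counting
  let B : (M ⧸ N) →+ S →+ ZMod n :=
    AddMonoidHom.mk' (fun w => ((ρ.quotient N hN).zeroTwoHom ω ι htriv w).comp S.subtype)
      fun w w' => by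
        refine AddMonoidHom.ext fun s => ?_
        simp only [map_add, AddMonoidHom.add_apply, AddMonoidHom.coe_comp, Function.comp_apply]
  have hH2n : ∀ z : continuousCohomology 2 ((ρ.quotient N hN).homRep ω).toTopRep, n • z = 0 :=
    (ρ.quotient N hN).nsmul_continuousCohomology_homRep_eq_zero ω hQn
  have hSn : ∀ s : S, n • s = 0 := fun s => Subtype.ext (by
    rw [AddSubmonoidClass.coe_nsmul]
    exact hH2n s.1)
  have hBnd : ∀ s : S, (∀ w, B w s = 0) → s = 0 := fun s hs =>
    Subtype.ext (h02 (M ⧸ N) (ρ.quotient N hN) htriv hcard s.1 fun w => hs w)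
  obtain ⟨w, hw⟩ := exists_apply_eq_of_rightNondegenerate hpn hcard hSn B hBnd (-lamBar)
  -- Step 6: `a₁ - δ₀ w` pairs to zero with all of `H¹(N^D)`
  have hwinv : (w : M ⧸ N) ∈ (ρ.quotient N hN).toTopRep.ρ.invariants := fun g => htriv g w
  have hzt : ∀ y, (ρ.quotient N hN).zeroTwo ω ι w (htriv · w) (hSES₂.δ₁ y) = -lam y := fun y => by
    have e : B w ⟨hSES₂.δ₁ y, AddMonoidHom.mem_range.2 ⟨y, rfl⟩⟩ =
        (-lamBar) ⟨hSES₂.δ₁ y, AddMonoidHom.mem_range.2 ⟨y, rfl⟩⟩ :=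
      congrArg (fun φ : S →+ ZMod n => φ ⟨hSES₂.δ₁ y, AddMonoidHom.mem_range.2 ⟨y, rfl⟩⟩) hw
    refine e.trans ?_
    rw [AddMonoidHom.neg_apply, hlamBar]
  have h6 : (ρ.subrepresentation N hN).dualityPairing ω ι (a₁ - hSES₁.δ₀ ⟨w, hwinv⟩) = 0 := by
    rw [map_sub]
    refine AddMonoidHom.ext fun y => ?_
    rw [AddMonoidHom.sub_apply, AddMonoidHom.zero_apply]
    have ec := cupProduct_δ₀_eq_neg_map_δ₁ hSES₁ hSES₂ (ρ.evalPairing ω)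
      ((ρ.subrepresentation N hN).evalPairing ω) ((ρ.quotient N hN).evalPairing ω)
      (fun _ _ => rfl) (fun _ _ => rfl) ⟨w, hwinv⟩ y
    have e2 : (ρ.subrepresentation N hN).dualityPairing ω ι (hSES₁.δ₀ ⟨w, hwinv⟩) y = lam y :=
      calc (ρ.subrepresentation N hN).dualityPairing ω ι (hSES₁.δ₀ ⟨w, hwinv⟩) y
          = ι (((ρ.subrepresentation N hN).evalPairing ω).cupProduct (hSES₁.δ₀ ⟨w, hwinv⟩) y) := rfl
        _ = ι (-cohomologyMap (((ρ.quotient N hN).evalPairing ω).leftHom w hwinv) 2 (hSES₂.δ₁ y)) :=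
            congrArg ι ec
        _ = -(ρ.quotient N hN).zeroTwo ω ι w (htriv · w) (hSES₂.δ₁ y) := map_neg ι _
        _ = lam y := by rw [hzt y, neg_neg]
    rw [e2, sub_self]
  -- Step 7: by induction `a₁ = δ₀ w`, so `a = H¹(ι)(δ₀ w) = 0`
  have h7 : a₁ - hSES₁.δ₀ ⟨w, hwinv⟩ = 0 := (injective_iff_map_eq_zero _).1 ihN _ h6
  rw [sub_eq_zero] at h7
  rw [h7]
  exact hSES₁.map_one_δ₀ _

end Devissage

end Literature.NumberTheory.GaloisRepresentations

end
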